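import Literature.NumberTheory.LFunctions.LevinFainleibProduct
import Mathlib.NumberTheory.EulerProduct.Basic
import Mathlib.NumberTheory.LSeries.RiemannZeta
import HarnessLib

/-!
# Levin–Faĭnleĭb mean-value theorem, IV: the Dirichlet series `∑ g(n) n^{-s}` for `s > 0`

Topic `Literature/NumberTheory/LFunctions`. Fourth file of the proof of the logarithmic mean-value
theorem of Levin–Faĭnleĭb / Halberstam–Richert (Lemma 5.4) in asymptotic form
(`LevinFainleibTauberian.lean`).  Everything here is PROVED.

For `s > 0` the Dirichlet series `D(s) = ∑ g(n) n^{-s}` of the non-negative multiplicative `g`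
converges and equals its Euler product `∏_p F_p(s)` (Mathlib's `EulerProduct.eulerProduct`, after the
a-priori bound `∑_{n < N} g(n) n^{-s} ≤ ∏_{p < N} F_p(s) ≤ e^{Φ_N(s)} ζ(1+s)^κ` over smooth numbers,
Hall–Tenenbaum (0.4)), while `∏_{p ≤ N} (1 − p^{-1-s})^{-1} → ζ(1+s) = ∑ n^{-1-s}` (the real Euler
product of `ζ`, `tendsto_prod_primesLE_zeta`).  Comparing with file III
(`exp Φ_N(s) = ∏_{p ≤ N} F_p(s)(1 − p^{-1-s})^κ → exp Φ(s)`) gives the **Abelian asymptotics**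
`D(s) = e^{Φ(s)} ζ(1+s)^κ` and `s^κ D(s) = e^{Φ(s)} (s ζ(1+s))^κ → e^{Φ(0)}` as `s → 0⁺`
(`tsum_div_rpow_eq`, `tendsto_rpow_mul_tsum_div_rpow`, `tendsto_rpow_mul_tsum_sigma`), by the
continuity of `Φ` at `0` and the simple pole of `ζ` (Mathlib's `tendsto_sub_mul_tsum_nat_rpow`).

## References
* H. Halberstam, H.-E. Richert, *Sieve Methods*, Academic Press 1974, Lemma 5.4.
* G. Tenenbaum, *Introduction to analytic and probabilistic number theory*, 3rd ed., AMS 2015,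
  §II.5 and §III.3–4.
-/

namespace Literature.NumberTheory.LFunctions

namespace LevinFainleib

open Finset Real Filter
open scoped _root_.Topology

/-! ### The real Euler product of `ζ(σ)`, `σ > 1` -/

/-- For a prime `p` and `σ > 0`: `0 ≤ p^{-σ} < 1`. [folklore] -/
theorem one_div_prime_rpow_lt_one {p : ℕ} (hp : p.Prime) {σ : ℝ} (hσ : 0 < σ) :
    0 ≤ 1 / (p : ℝ) ^ σ ∧ 1 / (p : ℝ) ^ σ < 1 := by
  have hp1 : (1 : ℝ) < p := by exact_mod_cast hp.one_lt
  refine ⟨div_nonneg zero_le_one (Real.rpow_nonneg (by linarith) _), ?_⟩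
  rw [div_lt_one (Real.rpow_pos_of_pos (by linarith) _)]
  exact Real.one_lt_rpow hp1 hσ

/-- The geometric local factor: `∑_e (p^e)^{-σ} = (1 − p^{-σ})^{-1}` (`σ > 0`). [folklore] -/
theorem tsum_one_div_prime_pow_rpow {p : ℕ} (hp : p.Prime) {σ : ℝ} (hσ : 0 < σ) :
    ∑' e : ℕ, 1 / ((p ^ e : ℕ) : ℝ) ^ σ = (1 - 1 / (p : ℝ) ^ σ)⁻¹ := by
  have hp0 : (0 : ℝ) ≤ p := Nat.cast_nonneg _
  obtain ⟨hr0, hr1⟩ := one_div_prime_rpow_lt_one hp hσ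
  have : ∀ e : ℕ, 1 / ((p ^ e : ℕ) : ℝ) ^ σ = (1 / (p : ℝ) ^ σ) ^ e := by
    intro e
    rw [Nat.cast_pow, ← Real.rpow_pow_comm hp0, one_div_pow]
  simp_rw [this]
  exact tsum_geometric_of_lt_one hr0 hr1

/-- **The real Euler product of `ζ`**: for real `σ > 1`,
`∏_{p ≤ N} (1 − p^{-σ})^{-1} → ∑_n n^{-σ}` (from Mathlib's general Euler product for the
multiplicative function `n ↦ n^{-σ}`). [folklore] -/
theorem tendsto_prod_primesLE_zeta {σ : ℝ} (hσ : 1 < σ) :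
    Tendsto (fun N : ℕ => ∏ p ∈ Nat.primesLE N, (1 - 1 / (p : ℝ) ^ σ)⁻¹) atTop
      (𝓝 (∑' n : ℕ, 1 / (n : ℝ) ^ σ)) := by
  have hsum : Summable (fun n : ℕ => ‖1 / (n : ℝ) ^ σ‖) := by
    refine (Real.summable_one_div_nat_rpow.mpr hσ).congr fun n => ?_
    rw [Real.norm_of_nonneg (div_nonneg zero_le_one (Real.rpow_nonneg (Nat.cast_nonneg _) _))]
  have hmul : ∀ {m n : ℕ}, m.Coprime n →
      1 / ((m * n : ℕ) : ℝ) ^ σ = 1 / (m : ℝ) ^ σ * (1 / (n : ℝ) ^ σ) := by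
    intro m n _
    rw [Nat.cast_mul, Real.mul_rpow (Nat.cast_nonneg _) (Nat.cast_nonneg _), one_div_mul_one_div]
  have h0 : 1 / ((0 : ℕ) : ℝ) ^ σ = 0 := by
    rw [Nat.cast_zero, Real.zero_rpow (by linarith), div_zero]
  have h := EulerProduct.eulerProduct (f := fun n : ℕ => 1 / (n : ℝ) ^ σ) (by simp) hmul hsum h0
  refine (h.comp (tendsto_add_atTop_nat 1)).congr fun N => ?_
  rw [Function.comp_apply]
  change ∏ p ∈ Nat.primesLE N, ∑' e : ℕ, 1 / ((p ^ e : ℕ) : ℝ) ^ σ = _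
  exact Finset.prod_congr rfl fun p hp =>
    tsum_one_div_prime_pow_rpow (Nat.prime_of_mem_primesLE hp) (by linarith)

/-- The partial Euler products are bounded by `ζ(σ)`: `∏_{p ≤ N} (1 − p^{-σ})^{-1} ≤ ∑_n n^{-σ}`.
[folklore] -/
theorem prod_primesLE_le_zeta {σ : ℝ} (hσ : 1 < σ) (N : ℕ) :
    ∏ p ∈ Nat.primesLE N, (1 - 1 / (p : ℝ) ^ σ)⁻¹ ≤ ∑' n : ℕ, 1 / (n : ℝ) ^ σ := by
  have hfac : ∀ M, ∀ p ∈ Nat.primesLE M, 1 ≤ (1 - 1 / (p : ℝ) ^ σ)⁻¹ := by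
    intro M p hp
    obtain ⟨h0, h1⟩ := one_div_prime_rpow_lt_one (Nat.prime_of_mem_primesLE hp)
      (by linarith : 0 < σ)
    rw [one_le_inv₀ (by linarith)]
    linarith
  have hmono : Monotone (fun N : ℕ => ∏ p ∈ Nat.primesLE N, (1 - 1 / (p : ℝ) ^ σ)⁻¹) := by
    intro M N hMN
    have hst := Nat.primesLE_mono hMN
    dsimp only
    rw [← Finset.prod_sdiff hst]
    -- enlarging a product of reals by factors `≥ 1` (as in the tree's
    -- `Literature.NumberTheory.Sieve.HoffsteinLuo.prod_le_prod_of_subset_real`)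
    exact le_mul_of_one_le_left
      (Finset.prod_nonneg fun i hi => zero_le_one.trans (hfac N i (hst hi)))
      (Finset.one_le_prod fun i hi => hfac N i (Finset.mem_sdiff.mp hi).1)
  exact hmono.ge_of_tendsto (tendsto_prod_primesLE_zeta hσ) N

/-- `0 < ∑_n n^{-σ}` for `σ > 1`. [folklore] -/
theorem zeta_pos {σ : ℝ} (hσ : 1 < σ) : 0 < ∑' n : ℕ, 1 / (n : ℝ) ^ σ :=
  lt_of_lt_of_le one_pos (by simpa using prod_primesLE_le_zeta hσ 0)

/-! ### The Dirichlet series `∑ g(n) n^{-s}` for `s > 0` -/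

section Dirichlet

variable {g : ℕ → ℝ} {κ A : ℝ}

/-- `n ↦ g(n) n^{-s}` is multiplicative on coprime arguments when `g` is. [folklore] -/
theorem div_rpow_mul_of_coprime (hmul : ∀ m n : ℕ, m.Coprime n → g (m * n) = g m * g n)
    (s : ℝ) {m n : ℕ} (hmn : m.Coprime n) :
    g (m * n) / ((m * n : ℕ) : ℝ) ^ s = g m / (m : ℝ) ^ s * (g n / (n : ℝ) ^ s) := by
  rw [hmul m n hmn, Nat.cast_mul, Real.mul_rpow (Nat.cast_nonneg _) (Nat.cast_nonneg _)]
  ring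

/-- **The a-priori bound over smooth numbers**: for `s ≥ 0`,
`∑_{1 ≤ n < N} g(n) n^{-s} ≤ ∏_{p < N} F_p(s)` (as in Hall–Tenenbaum (0.4)). [folklore] -/
theorem sum_Ico_div_rpow_le_prod (hg0 : ∀ n, 0 ≤ g n) (hg1 : g 1 = 1)
    (hmul : ∀ m n : ℕ, m.Coprime n → g (m * n) = g m * g n)
    (hloc : ∀ p : ℕ, p.Prime → Summable fun ν => g (p ^ ν)) {s : ℝ} (hs : 0 ≤ s) (N : ℕ) :
    ∑ n ∈ Ico 1 N, g n / (n : ℝ) ^ s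
      ≤ ∏ p ∈ Nat.primesBelow N, ∑' ν, g (p ^ ν) / ((p ^ ν : ℕ) : ℝ) ^ s := by
  classical
  set F : ℕ → ℝ := fun n => g n / (n : ℝ) ^ s with hF
  have hF1 : F 1 = 1 := by simp [hF, hg1]
  have hFmul : ∀ {m n : ℕ}, m.Coprime n → F (m * n) = F m * F n :=
    fun hmn => div_rpow_mul_of_coprime hmul s hmn
  have hF0 : ∀ n, 0 ≤ F n := fun n => div_nonneg (hg0 n) (Real.rpow_nonneg (Nat.cast_nonneg _) _)
  have hsumF : ∀ {p : ℕ}, p.Prime → Summable (fun ν : ℕ => ‖F (p ^ ν)‖) := by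
    intro p hp
    refine (summable_term hg0 (hloc p hp) hp hs).congr fun ν => ?_
    rw [Real.norm_of_nonneg (hF0 _)]
  obtain ⟨-, hhas⟩ :=
    EulerProduct.summable_and_hasSum_smoothNumbers_prod_primesBelow_tsum hF1 hFmul hsumF N
  have h1 : ∑ n ∈ Ico 1 N, F n = ∑ m ∈ (Ico 1 N).subtype (· ∈ N.smoothNumbers), F (m : ℕ) := by
    rw [Finset.sum_subtype_eq_sum_filter]
    refine Finset.sum_congr ?_ fun _ _ => rfl
    refine (Finset.filter_true_of_mem fun d hd => ?_).symm
    rw [Finset.mem_Ico] at hd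
    exact Nat.mem_smoothNumbers_of_lt hd.1 hd.2
  calc ∑ n ∈ Ico 1 N, g n / (n : ℝ) ^ s = ∑ n ∈ Ico 1 N, F n := rfl
    _ = _ := h1
    _ ≤ ∏ p ∈ N.primesBelow, ∑' ν : ℕ, F (p ^ ν) := sum_le_hasSum _ (fun m _ => hF0 _) hhas
    _ = _ := rfl

/-- `∏_{p ≤ N} F_p(s) = exp Φ_N(s) · (∏_{p ≤ N} (1 − p^{-1-s})^{-1})^κ` for `s ≥ 0`. [folklore] -/
theorem prod_tsum_term_eq (hg0 : ∀ n, 0 ≤ g n) (hg1 : g 1 = 1)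
    (h2 : ∀ N : ℕ, (∑ p ∈ Nat.primesLE N, g p ^ 2 * Real.log p) +
      (∑ p ∈ Nat.primesLE N, ∑ ν ∈ Icc 2 N, g (p ^ ν) * Real.log ((p : ℝ) ^ ν)) ≤ A)
    (κ : ℝ) {s : ℝ} (hs : 0 ≤ s) (N : ℕ) :
    ∏ p ∈ Nat.primesLE N, ∑' ν, g (p ^ ν) / ((p ^ ν : ℕ) : ℝ) ^ s
      = Real.exp (∑ p ∈ Nat.primesLE N, (Real.log (∑' ν, g (p ^ ν) / ((p ^ ν : ℕ) : ℝ) ^ s)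
          + κ * Real.log (1 - 1 / (p : ℝ) ^ (1 + s))))
        * (∏ p ∈ Nat.primesLE N, (1 - 1 / (p : ℝ) ^ (1 + s))⁻¹) ^ κ := by
  have hpos : ∀ p ∈ Nat.primesLE N, 0 < 1 - 1 / (p : ℝ) ^ (1 + s) := fun p hp =>
    one_sub_inv_rpow_pos (Nat.prime_of_mem_primesLE hp) hs
  rw [exp_logProduct_eq hg0 hg1 h2 κ hs N, Finset.prod_mul_distrib,
    Real.finsetProd_rpow _ _ (fun p hp => (hpos p hp).le), mul_assoc,
    ← Real.mul_rpow (Finset.prod_nonneg fun p hp => (hpos p hp).le)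
      (Finset.prod_nonneg fun p hp => (inv_pos.mpr (hpos p hp)).le),
    ← Finset.prod_mul_distrib,
    Finset.prod_congr rfl fun p hp => mul_inv_cancel₀ (hpos p hp).ne']
  simp

/-- **Convergence of the Dirichlet series**: for `s > 0`, `n ↦ g(n) n^{-s}` is summable, its
partial sums being bounded by `e^{Φ_N(s)} ζ(1+s)^κ`. [cite: HalberstamRichert1974, Lemma 5.4] -/
theorem summable_div_rpow (hg0 : ∀ n, 0 ≤ g n) (hg1 : g 1 = 1)
    (hmul : ∀ m n : ℕ, m.Coprime n → g (m * n) = g m * g n) (hκ : 0 ≤ κ)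
    (h2 : ∀ N : ℕ, (∑ p ∈ Nat.primesLE N, g p ^ 2 * Real.log p) +
      (∑ p ∈ Nat.primesLE N, ∑ ν ∈ Icc 2 N, g (p ^ ν) * Real.log ((p : ℝ) ^ ν)) ≤ A)
    {s : ℝ} (hs : 0 < s) {Φs : ℝ}
    (hΦ : Tendsto (fun N : ℕ => ∑ p ∈ Nat.primesLE N,
        (Real.log (∑' ν, g (p ^ ν) / ((p ^ ν : ℕ) : ℝ) ^ s)
          + κ * Real.log (1 - 1 / (p : ℝ) ^ (1 + s)))) atTop (𝓝 Φs)) :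
    Summable fun n : ℕ => g n / (n : ℝ) ^ s := by
  obtain ⟨C, hC⟩ := hΦ.bddAbove_range
  have hZ := zeta_pos (by linarith : 1 < 1 + s)
  refine summable_of_sum_range_le (c := Real.exp C * (∑' n : ℕ, 1 / (n : ℝ) ^ (1 + s)) ^ κ)
    (fun n => div_nonneg (hg0 n) (Real.rpow_nonneg (Nat.cast_nonneg _) _)) (fun N => ?_)
  rcases Nat.eq_zero_or_pos N with rfl | hN
  · simp only [Finset.range_zero, Finset.sum_empty]; positivity
  rw [Finset.sum_range_eq_add_Ico _ hN, Nat.cast_zero, Real.zero_rpow hs.ne', div_zero, zero_add]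
  refine (sum_Ico_div_rpow_le_prod hg0 hg1 hmul (fun p hp => summable_prime_pow hg0 h2 hp)
    hs.le N).trans ?_
  rw [Nat.primesBelow_eq_primesLE_sub_one, prod_tsum_term_eq hg0 hg1 h2 κ hs.le (N - 1)]
  have hprod0 : 0 ≤ ∏ p ∈ Nat.primesLE (N - 1), (1 - 1 / (p : ℝ) ^ (1 + s))⁻¹ :=
    Finset.prod_nonneg fun p hp =>
      (inv_pos.mpr (one_sub_inv_rpow_pos (Nat.prime_of_mem_primesLE hp) hs.le)).le
  exact mul_le_mul (Real.exp_le_exp.mpr (hC ⟨N - 1, rfl⟩))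
    (Real.rpow_le_rpow hprod0 (prod_primesLE_le_zeta (by linarith) _) hκ)
    (Real.rpow_nonneg hprod0 _) (Real.exp_pos _).le

/-- **The Euler product of `∑ g(n) n^{-s}`** (`s > 0`): `∏_{p ≤ N} F_p(s) → ∑_n g(n) n^{-s}`.
[folklore] -/
theorem tendsto_prod_tsum_term (hg1 : g 1 = 1)
    (hmul : ∀ m n : ℕ, m.Coprime n → g (m * n) = g m * g n) {s : ℝ} (hs : 0 < s)
    (hsum : Summable fun n : ℕ => g n / (n : ℝ) ^ s) :
    Tendsto (fun N : ℕ => ∏ p ∈ Nat.primesLE N, ∑' ν, g (p ^ ν) / ((p ^ ν : ℕ) : ℝ) ^ s) atTop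
      (𝓝 (∑' n : ℕ, g n / (n : ℝ) ^ s)) := by
  have hsum' : Summable (fun n : ℕ => ‖g n / (n : ℝ) ^ s‖) :=
    hsum.abs.congr fun n => (Real.norm_eq_abs _).symm
  have h0 : g 0 / ((0 : ℕ) : ℝ) ^ s = 0 := by rw [Nat.cast_zero, Real.zero_rpow hs.ne', div_zero]
  have h := EulerProduct.eulerProduct (f := fun n : ℕ => g n / (n : ℝ) ^ s) (by simp [hg1])
    (fun hmn => div_rpow_mul_of_coprime hmul s hmn) hsum' h0
  exact (h.comp (tendsto_add_atTop_nat 1)).congr fun N => rfl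

/-- **`∑_n g(n) n^{-s} = e^{Φ(s)} ζ(1+s)^κ`** for `s > 0`, where `Φ(s) = lim_N Φ_N(s)`.
[cite: HalberstamRichert1974, Lemma 5.4] -/
theorem tsum_div_rpow_eq (hg0 : ∀ n, 0 ≤ g n) (hg1 : g 1 = 1)
    (hmul : ∀ m n : ℕ, m.Coprime n → g (m * n) = g m * g n) (hκ : 0 ≤ κ)
    (h2 : ∀ N : ℕ, (∑ p ∈ Nat.primesLE N, g p ^ 2 * Real.log p) +
      (∑ p ∈ Nat.primesLE N, ∑ ν ∈ Icc 2 N, g (p ^ ν) * Real.log ((p : ℝ) ^ ν)) ≤ A)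
    {s : ℝ} (hs : 0 < s) {Φs : ℝ}
    (hΦ : Tendsto (fun N : ℕ => ∑ p ∈ Nat.primesLE N,
        (Real.log (∑' ν, g (p ^ ν) / ((p ^ ν : ℕ) : ℝ) ^ s)
          + κ * Real.log (1 - 1 / (p : ℝ) ^ (1 + s)))) atTop (𝓝 Φs)) :
    ∑' n : ℕ, g n / (n : ℝ) ^ s = Real.exp Φs * (∑' n : ℕ, 1 / (n : ℝ) ^ (1 + s)) ^ κ := by
  have hsum := summable_div_rpow hg0 hg1 hmul hκ h2 hs hΦ
  have hD := tendsto_prod_tsum_term hg1 hmul hs hsum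
  have hZ := tendsto_prod_primesLE_zeta (by linarith : 1 < 1 + s)
  have hE : Tendsto (fun N : ℕ => ∏ p ∈ Nat.primesLE N, ∑' ν, g (p ^ ν) / ((p ^ ν : ℕ) : ℝ) ^ s)
      atTop (𝓝 (Real.exp Φs * (∑' n : ℕ, 1 / (n : ℝ) ^ (1 + s)) ^ κ)) := by
    refine (((Real.continuous_exp.tendsto _).comp hΦ).mul (hZ.rpow_const (Or.inr hκ))).congr
      fun N => ?_
    rw [Function.comp_apply]
    exact (prod_tsum_term_eq hg0 hg1 h2 κ hs.le N).symm
  exact tendsto_nhds_unique hD hE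

/-- `s ↦ 1 + s` maps `𝓝[>] 0` to `𝓝[>] 1`, and `σ ↦ σ − 1` maps back. [folklore] -/
theorem tendsto_one_add_nhdsWithin :
    Tendsto (fun s : ℝ => 1 + s) (𝓝[>] 0) (𝓝[>] 1)
      ∧ Tendsto (fun σ : ℝ => σ - 1) (𝓝[>] 1) (𝓝[>] 0) := by
  constructor
  · rw [tendsto_nhdsWithin_iff]
    constructor
    · have h : Tendsto (fun s : ℝ => 1 + s) (𝓝 0) (𝓝 (1 + 0)) :=
        (continuous_const.add continuous_id).tendsto 0
      rw [add_zero] at h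
      exact h.mono_left nhdsWithin_le_nhds
    · filter_upwards [self_mem_nhdsWithin] with s hs
      rw [Set.mem_Ioi] at hs ⊢
      linarith
  · rw [tendsto_nhdsWithin_iff]
    constructor
    · have h : Tendsto (fun σ : ℝ => σ - 1) (𝓝 1) (𝓝 (1 - 1)) :=
        (continuous_id.sub continuous_const).tendsto 1
      rw [sub_self] at h
      exact h.mono_left nhdsWithin_le_nhds
    · filter_upwards [self_mem_nhdsWithin] with s hs
      rw [Set.mem_Ioi] at hs ⊢
      linarith

/-- **Abelian asymptotics**: `s^κ ∑_n g(n) n^{-s} → e^{Φ(0)}` as `s → 0⁺`, since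
`s^κ D(s) = e^{Φ(s)} (s ζ(1+s))^κ`, `Φ` is right-continuous at `0` and `s ζ(1+s) → 1`.
[cite: HalberstamRichert1974, Lemma 5.4] -/
theorem tendsto_rpow_mul_tsum_div_rpow (hg0 : ∀ n, 0 ≤ g n) (hg1 : g 1 = 1)
    (hmul : ∀ m n : ℕ, m.Coprime n → g (m * n) = g m * g n) (hκ : 0 ≤ κ)
    (h2 : ∀ N : ℕ, (∑ p ∈ Nat.primesLE N, g p ^ 2 * Real.log p) +
      (∑ p ∈ Nat.primesLE N, ∑ ν ∈ Icc 2 N, g (p ^ ν) * Real.log ((p : ℝ) ^ ν)) ≤ A)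
    {Φ : ℝ → ℝ}
    (hΦ : ∀ s : ℝ, 0 ≤ s → Tendsto (fun N : ℕ => ∑ p ∈ Nat.primesLE N,
        (Real.log (∑' ν, g (p ^ ν) / ((p ^ ν : ℕ) : ℝ) ^ s)
          + κ * Real.log (1 - 1 / (p : ℝ) ^ (1 + s)))) atTop (𝓝 (Φ s)))
    (hcont : ContinuousOn Φ (Set.Ici 0)) :
    Tendsto (fun s : ℝ => s ^ κ * ∑' n : ℕ, g n / (n : ℝ) ^ s) (𝓝[>] 0)
      (𝓝 (Real.exp (Φ 0))) := by
  -- `s ζ(1+s) → 1`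
  have hζ : Tendsto (fun s : ℝ => s * ∑' n : ℕ, 1 / (n : ℝ) ^ (1 + s)) (𝓝[>] 0) (𝓝 1) := by
    refine (tendsto_sub_mul_tsum_nat_rpow.comp tendsto_one_add_nhdsWithin.1).congr fun s => ?_
    simp only [Function.comp_apply, add_sub_cancel_left]
  -- `Φ s → Φ 0`
  have hΦ0 : Tendsto Φ (𝓝[>] 0) (𝓝 (Φ 0)) :=
    (hcont 0 (Set.mem_Ici.mpr le_rfl)).tendsto.mono_left (nhdsWithin_mono _ Set.Ioi_subset_Ici_self)
  have hmain : Tendsto (fun s : ℝ => Real.exp (Φ s) * (s * ∑' n : ℕ, 1 / (n : ℝ) ^ (1 + s)) ^ κ)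
      (𝓝[>] 0) (𝓝 (Real.exp (Φ 0) * (1 : ℝ) ^ κ)) :=
    ((Real.continuous_exp.tendsto _).comp hΦ0).mul (hζ.rpow_const (Or.inl one_ne_zero))
  rw [Real.one_rpow, mul_one] at hmain
  refine hmain.congr' ?_
  filter_upwards [self_mem_nhdsWithin] with s hs
  rw [Set.mem_Ioi] at hs
  rw [tsum_div_rpow_eq hg0 hg1 hmul hκ h2 hs (hΦ s hs.le),
    Real.mul_rpow hs.le (zeta_pos (by linarith)).le]
  ring

/-- The change of variables `σ = 1 + s` in the Dirichlet series: for `σ > 1`,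
`(n · g n) n^{-σ} = g(n) n^{-(σ-1)}` termwise (both sides vanish at `n = 0`). [folklore] -/
theorem mul_div_rpow_eq_div_rpow_sub_one (g : ℕ → ℝ) {σ : ℝ} (hσ : 1 < σ) (n : ℕ) :
    (n : ℝ) * g n / (n : ℝ) ^ σ = g n / (n : ℝ) ^ (σ - 1) := by
  rcases Nat.eq_zero_or_pos n with rfl | hn
  · simp [Real.zero_rpow (by linarith : σ - 1 ≠ 0)]
  · have hn0 : (n : ℝ) ≠ 0 := by exact_mod_cast hn.ne'
    rw [Real.rpow_sub_one hn0, div_div_eq_mul_div, mul_comm]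

/-- **Abelian asymptotics in the variable `σ = 1 + s`**:
`(σ−1)^κ ∑_n (n g(n)) n^{-σ} → e^{Φ(0)}` as `σ → 1⁺` — the analytic hypothesis of the
Hardy–Littlewood–Karamata Tauberian theorem for the coefficients `a_n = n g(n)`.
[cite: HalberstamRichert1974, Lemma 5.4] -/
theorem tendsto_rpow_mul_tsum_sigma (hg0 : ∀ n, 0 ≤ g n) (hg1 : g 1 = 1)
    (hmul : ∀ m n : ℕ, m.Coprime n → g (m * n) = g m * g n) (hκ : 0 ≤ κ)
    (h2 : ∀ N : ℕ, (∑ p ∈ Nat.primesLE N, g p ^ 2 * Real.log p) +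
      (∑ p ∈ Nat.primesLE N, ∑ ν ∈ Icc 2 N, g (p ^ ν) * Real.log ((p : ℝ) ^ ν)) ≤ A)
    {Φ : ℝ → ℝ}
    (hΦ : ∀ s : ℝ, 0 ≤ s → Tendsto (fun N : ℕ => ∑ p ∈ Nat.primesLE N,
        (Real.log (∑' ν, g (p ^ ν) / ((p ^ ν : ℕ) : ℝ) ^ s)
          + κ * Real.log (1 - 1 / (p : ℝ) ^ (1 + s)))) atTop (𝓝 (Φ s)))
    (hcont : ContinuousOn Φ (Set.Ici 0)) :
    Tendsto (fun σ : ℝ => (σ - 1) ^ κ * ∑' n : ℕ, (n : ℝ) * g n / (n : ℝ) ^ σ) (𝓝[>] 1)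
      (𝓝 (Real.exp (Φ 0))) := by
  refine ((tendsto_rpow_mul_tsum_div_rpow hg0 hg1 hmul hκ h2 hΦ hcont).comp
    tendsto_one_add_nhdsWithin.2).congr' ?_
  filter_upwards [self_mem_nhdsWithin] with σ hσ
  rw [Set.mem_Ioi] at hσ
  simp only [Function.comp_apply, mul_div_rpow_eq_div_rpow_sub_one g hσ]

end Dirichlet

end LevinFainleib

end Literature.NumberTheory.LFunctions
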